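import Summits.QuantumFields.BalabanUV.Beta.GAN24.PerturbedInsertionChainDecay

/-!
# `BalabanUV.Beta.GAN24.PerturbedInsertionChainVolumeLimit` — binder row G-an2-4 ∕ (CONV-C), route R7 «TWO CURRENCIES», PART 162 (volume half): THE INSERTION CHAINS AT A COUPLING `u₀ ≠ 0`.
# `X^{(n)}_k(u) = L^{dk}Q_k((𝒢(u)P)^n𝒢(u))Q_kᴴ`, `𝒢(u) = (Δ_a + uP(V))⁻¹` (the letters of the Taylor expansion of the effective form with background at the base point `u`, PART 161),
# have EL₂ MODULO ONLY the background's pointwise limit (this file) and (UD)+(SR) volume-free on PART 129's disc (the first file `PerturbedInsertionChainDecay`) — the `u ≠ 0` twin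
# of PART 156 ∕ 159.  §4 EL₂: powers of the left-window-decaying letter `P𝒢(u)` (PART 159 §1's induction; the first file's `fineWindowDecay_pertInv`; PART 151's
# `tendsto_pertInv_pair` and middle-free stencil); §5 the INPUT triple along the even cubic volumes, the format of PART 160's `list_prod_inputs`
# (unit b2b-balaban-gan24-p3, gen 56; v1)

NOT IN PRINT; OUR PROOF ([folklore] bookkeeping BY NAME over NE2's `opNorm_conjMat_pertInv_le_of_wCoercive` ∕ `isUnit_det_conjMat_of_wCoercive` ∕ `conjMat_inv ∕ _add ∕ _smul`,
PART 120 (`opNorm_P_mul_perturbed_le`, `towerLimitRate_insertion_at_coupling`), PART 124 (`opNorm_conjMat_insertion_le`, `hPc_firstOrder`), PART 126 (`hdecB_of_conjBound`,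
`conjMat_sub_const`, `rho_le_one_of_near`, `distK_sub_three_le_rho_of_near`), PART 145 (`single_pairing`, `nsq_single`, `wCoercive_sub_const`, `l1_windowMap_le_block`), PART 144
(`tendsto_mul_pair'`), PART 146 (`norm_mul_apply_le_of_window`), PART 151 (`norm_Pmodel_mul_apply_le`, `tendsto_Pmodel_mul_pair`, `tendsto_pertInv_pair`, `tendsto_avgTow_pair_of_fine`),
PART 159 (`tendsto_one_pair`), `decayRate_of_towerLimitRate`; [Balaban1987RG1] (1.21)–(1.22) p. 264 LOCATE the shapes; nothing printed is a hypothesis).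
HONEST FRAMING (cell contract, verbatim): «discharging `BetaPertH` makes Bałaban's UV stability UNCONDITIONAL — a real constructive-QFT result; it is NOT the
continuum limit and NOT the Clay problem.»  HONEST DEPENDENCY (verbatim): «continuum YM on T⁴ ⇐ BetaPertH ∧ nine spine estimates (0/9 proved); BetaPertH ⇐
(D1) ∧ (D4) ∧ CAP+tail; G-an2-4 gates asym, D1 and NE2/3/4.»

WHAT THIS FILE PROVES (0 sorry, 0 `def`; `R_k(u) = (Δ_a^{(k)} + uP(V)^{(k)})⁻¹`, `X^{(n)}_k(u) = avgTow QBlev (L^d) (k ↦ (R_k(u)P^{(k)})^nR_k(u)) k`; PART 129's disc: `a′ > 0`, `κ > 0` admissible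
(`Jfree < gammaPs`, `deltaK < sigma0²`, `JA < gamD`), `‖u‖ ≤ T`, `Tκ₀ ≤ 1∕2` (`κ₀ = d(α+β)Cst`), `Tκ_c ≤ 1∕2` (`κ_c = d·α·G2`), `4Tκ₀Cst ≤ γ_B` where EL₂ of `c_k(u)⁻¹` is used):
* §4 (GENERIC) `pow_bound_tendsto`; (`d ≥ 3`, even volumes) **`tendsto_pertChain_fine_pair`**, **`tendsto_pertChain_pair`** (EL₂ of `X^{(n)}(u)` modulo EL₁ of `V_t`).
* §5 **`pertChain_inputs`** — the INPUT triple ((UD), (SR), EL₂) of `X^{(n)}(u)` along the even cubic volumes, the format of PART 160's `list_prod_inputs`.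
WHAT IT DOES NOT DO: (UD)+(SR) (the first file); the letters `c_k(u)⁻¹` (PART 129 ∕ 152) and the END for the derivatives at `u₀` (PART 163); mixed words at `u₀ ≠ 0` (several backgrounds); `d ≤ 2` ∕ odd volumes.
SUPPLIER work; NEVER «G-an2-4 closed»; NOT (CONV-C), NOT D1, NOT `BetaPertH`, NOT continuum, NOT Clay.  Records: `HOME/b2b-balaban-gan24-p3/gen56/README.md`.
-/

noncomputable section

open scoped BigOperators ComplexConjugate Matrix Matrix.Norms.L2Operator
open Filter Topology

namespace Summit.QuantumFields.BalabanUV.Beta.GAN24.PerturbedInsertionChainVolumeLimit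

open Literature.MathematicalPhysics.QuantumFieldTheory.Balaban1983to89
open Literature.MathematicalPhysics.QuantumFieldTheory.Balaban1983to89.B5Prop11Plancherel (Tor fine Cst Cst_nonneg)
open Literature.MathematicalPhysics.QuantumFieldTheory.Balaban1983to89.B5Prop11Lower (nsq)
open Literature.MathematicalPhysics.QuantumFieldTheory.Balaban1983to89.B5G183RateUnitTower (lev)
open Literature.MathematicalPhysics.QuantumFieldTheory.Balaban1983to89.B12Sec2to5 (l1)
open Literature.MathematicalPhysics.QuantumFieldTheory.Balaban1983to89.Beta (Site windowMap)
open Literature.MathematicalPhysics.QuantumFieldTheory.Balaban1983to89.Beta.FreeLegDictionary (cubic)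
open Literature.MathematicalPhysics.QuantumFieldTheory.Balaban1983to89.Beta.BlockKernelVolumeSockets (evenPeriod tendsto_evenPeriod)
open Literature.MathematicalPhysics.QuantumFieldTheory.Balaban1983to89.Beta.VectorTails (castT)
open Literature.MathematicalPhysics.QuantumFieldTheory.Balaban1983to89.Beta.VectorTailsCov (tdist tdist_self)
open Summit.QuantumFields.BalabanUV.T4Continuum
open Summit.QuantumFields.BalabanUV.T4Continuum.CovariantAveragingTower (avgTow TowerLimitRate)
open Summit.QuantumFields.BalabanUV.T4Continuum.BalabanAveragedTowerUnit (idx QBlev calGlev one_le_lev')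
open Summit.QuantumFields.BalabanUV.T4Continuum.BalabanAveragedCoerciveTower (unitIdx)
open Summit.QuantumFields.BalabanUV.T4Continuum.BalabanAveragingPairing (freeTowerLaws_balaban)
open Summit.QuantumFields.BalabanUV.T4Continuum.BackgroundResolventLaw (isUnit_det_add_smul_right)
open Summit.QuantumFields.BalabanUV.T4Continuum.KingPairingPlantedLaw (calDalev calDalev_inv isUnit_det_calDalev CJ CJ_nonneg)
open Summit.QuantumFields.BalabanUV.T4Continuum.FirstOrderBackgroundModel (LipschitzBackground Pmodel C2model perturbationLaws_firstOrder)
open Summit.QuantumFields.BalabanUV.T4Continuum.CTWeightedCoercivity (conjMat conjMat_add conjMat_smul WCoercive)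
open Summit.QuantumFields.BalabanUV.T4Continuum.CTConjugationPieces (conjMat_inv)
open Summit.QuantumFields.BalabanUV.T4Continuum.CTAveragedTowerDecay (opNorm_conjMat_pertInv_le_of_wCoercive isUnit_det_conjMat_of_wCoercive pairing_le_of_opNorm_conjMat)
open Summit.QuantumFields.BalabanUV.T4Continuum.CTKingTowerWeights (rho distK toM)
open Summit.QuantumFields.BalabanUV.T4Continuum.CTConjugatedHbd (G2 G2_nonneg wCoercive_calDa_of_conjDefect)
open Summit.QuantumFields.BalabanUV.T4Continuum.CTConjDefectDischarge (conjDefect_calDalev_rho max_JA_lt_gamD)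
open Summit.QuantumFields.BalabanUV.T4Continuum.DirichletRegionTower (gamD)
open Summit.QuantumFields.BalabanUV.T4Continuum.ScalarAveragedPropagator (gammaPs)
open Summit.QuantumFields.BalabanUV.T4Continuum.ScalarAveragedCompression (sigma0)
open Summit.QuantumFields.BalabanUV.T4Continuum.CTScalarGreen (Jfree)
open Summit.QuantumFields.BalabanUV.T4Continuum.CTGaugeTerm (deltaK)
open Summit.QuantumFields.BalabanUV.T4Continuum.CTVectorPropagator (JA)
open Summit.QuantumFields.BalabanUV.T4Continuum.DecayRateInterpolation (EntryDecay DecayRate TwoLevelDecayRate decayRate_of_towerLimitRate)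
open Summit.QuantumFields.BalabanUV.Beta.GAN24.DiagramDecayAlgebra (entryDecay_add)
open Summit.QuantumFields.BalabanUV.Beta.GAN24.UnitLatticeDecayAlgebra (distK_nonneg toM_bijective)
open Summit.QuantumFields.BalabanUV.Beta.GAN24.EffectiveFormDecay (entryDecay_of_le_rate)
open Summit.QuantumFields.BalabanUV.Beta.GAN24.InsertionChainDecay (hPc_firstOrder opNorm_conjMat_insertion_le)
open Summit.QuantumFields.BalabanUV.Beta.GAN24.InsertionChainDecayBalaban (hdecB_of_conjBound conjMat_sub_const rho_le_one_of_near distK_sub_three_le_rho_of_near)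
open Summit.QuantumFields.BalabanUV.Beta.GAN24.InsertionChainLawCoupling (opNorm_P_mul_perturbed_le towerLimitRate_insertion_at_coupling)
open Summit.QuantumFields.BalabanUV.Beta.GAN24.DiagramVolumeLimitPairs (l1_windowMap_neg)
open Summit.QuantumFields.BalabanUV.Beta.GAN24.VolumeLimitPairsFibre (tendsto_mul_pair')
open Summit.QuantumFields.BalabanUV.Beta.GAN24.FinePropagatorDecay (single_pairing nsq_single wCoercive_sub_const l1_windowMap_le_block)
open Summit.QuantumFields.BalabanUV.Beta.GAN24.FineInsertionVolumeLimit (norm_mul_apply_le_of_window)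
open Summit.QuantumFields.BalabanUV.Beta.GAN24.PerturbedPropagatorVolumeLimit (tendsto_Pmodel_mul_pair norm_Pmodel_mul_apply_le tendsto_avgTow_pair_of_fine tendsto_pertInv_pair)
open Summit.QuantumFields.BalabanUV.Beta.GAN24.InsertionWordVolumeLimit (tendsto_one_pair)

open Summit.QuantumFields.BalabanUV.Beta.GAN24.PerturbedInsertionChainDecay (fineWindowDecay_pertInv pertChain_decay_inputs)

variable {d : ℕ} (L : ℕ) [NeZero L] (a : ℝ) (ha : 0 < a)

/-! ## §4 EL₂ of the insertion chains at coupling `u`, modulo the background's pointwise limit -/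

section ChainLimits

variable {F : Type*} [Fintype F] [DecidableEq F] {side : ℕ → ℕ} [∀ t, NeZero (side t)]

omit [NeZero L] in
/-- **powers of a left-window-decaying fine kernel with pair entry limits** [folklore] (`side t → ∞`, `δ > 0`): `A_t^j` is bounded by `(C_A·|F|·Σ_y e^{−δ|y|₁})^j` volume-free and has
EL₂, every `j` (PART 159 §1's induction for the constant word; the identity is `tendsto_one_pair`). -/
theorem pow_bound_tendsto (hside : Tendsto side atTop atTop)
    {A : (t : ℕ) → Matrix (Site d (side t) × F) (Site d (side t) × F) ℂ} {CA δ : ℝ} (hδ : 0 < δ) (hCA : 0 ≤ CA)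
    (hA : ∀ t (x : Site d (side t)) (f : F) (w : Site d (side t)) (g : F), ‖A t (x, f) (w, g)‖ ≤ CA * Real.exp (-δ * l1 (windowMap d (side t) (w - x))))
    (hAel : ∀ (f g : F) (z z' : Fin d → ℤ), ∃ s : ℂ, Tendsto (fun t => A t (castT (cubic d (side t)) z, f) (castT (cubic d (side t)) z', g)) atTop (𝓝 s))
    (j : ℕ) :
    (∀ t (x : Site d (side t)) (f : F) (y : Site d (side t)) (g : F),
        ‖(A t ^ j) (x, f) (y, g)‖ ≤ (CA * (Fintype.card F * ∑' y : Fin d → ℤ, Real.exp (-δ * l1 y))) ^ j) ∧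
      (∀ (f g : F) (z z' : Fin d → ℤ), ∃ s : ℂ,
        Tendsto (fun t => (A t ^ j) (castT (cubic d (side t)) z, f) (castT (cubic d (side t)) z', g)) atTop (𝓝 s)) := by
  have hS0 : 0 ≤ CA * (Fintype.card F * ∑' y : Fin d → ℤ, Real.exp (-δ * l1 y)) :=
    mul_nonneg hCA (mul_nonneg (Nat.cast_nonneg _) (tsum_nonneg fun _ => (Real.exp_pos _).le))
  induction j with
  | zero =>
    refine ⟨fun t x f y g => ?_, fun f g z z' => ?_⟩
    · rw [pow_zero, pow_zero, Matrix.one_apply]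
      split_ifs <;> simp
    · simp only [pow_zero]
      exact tendsto_one_pair (d := d) hside f g z z'
  | succ j ih =>
    obtain ⟨hb, hel⟩ := ih
    refine ⟨fun t x f y g => ?_, fun f g z z' => ?_⟩
    · rw [pow_succ', pow_succ]
      refine (norm_mul_apply_le_of_window (side t) hδ hCA (pow_nonneg hS0 _) (hA t) (hb t) x f y g).trans (le_of_eq ?_)
      ring
    · simp only [pow_succ']
      exact tendsto_mul_pair' (d := d) (F := F) hside (X := A) (Y := fun t => A t ^ j) hA hδ hb hAel hel f g z z'

/-- **`tendsto_pertChain_fine_pair` — EL₂ OF THE FINE CHAIN `(R_k(u)P)^nR_k(u) = R_k(u)(PR_k(u))^n` AT FINE INTEGER PAIRS, MODULO EL₁ OF THE BACKGROUND** [our proof] (`d ≥ 3`,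
even cubic volumes, PART 129's disc, `‖u‖ ≤ T`): `R_k(u)` is left-window-decaying volume-free (§2) with EL₂ (PART 151's `tendsto_pertInv_pair`); the letter `PR_k(u)` likewise
(PART 151's stencil lemmas); `pow_bound_tendsto` and PART 144's left-decaying pair product. [cite: Balaban1987RG1, p.264 (after (1.21): the `T ↗ ℤ^d` limit)] -/
theorem tendsto_pertChain_fine_pair (hd : 3 ≤ d) {α β a' κ T : ℝ} (ha' : 0 < a') (hκ0 : 0 < κ)
    (hγ' : Jfree d a' κ 1 < gammaPs d a') (hδ' : deltaK d a' κ 1 < sigma0 d a' ^ 2) (hJA : JA d a a' κ 1 < gamD d a)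
    (hT₁ : T * (d * (α + β) * Cst d a) ≤ 1 / 2)
    (hT₂ : T * (d * (α * G2 d a (max (JA d a a' κ 1) 0) (gamD d a - max (JA d a a' κ 1) 0) κ)) ≤ 1 / 2) (k : ℕ)
    {V : (t : ℕ) → (k : ℕ) → Fin d → (idx L (cubic d (evenPeriod t)) k → ℂ)} (hV : ∀ t, LipschitzBackground L (cubic d (evenPeriod t)) (V t) α β)
    (hV1 : ∀ (μ f : Fin d) (z : Fin d → ℤ), ∃ s : ℂ, Tendsto (fun t => V t k μ (castT (cubic d (lev L k * evenPeriod t)) z, f)) atTop (𝓝 s))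
    {u : ℂ} (hu : ‖u‖ ≤ T) (n : ℕ) (f g : Fin d) (z z' : Fin d → ℤ) :
    ∃ s : ℂ, Tendsto (fun t => (((calDalev L (cubic d (evenPeriod t)) a ha k + u • Pmodel L (cubic d (evenPeriod t)) (V t) k)⁻¹ * Pmodel L (cubic d (evenPeriod t)) (V t) k) ^ n
        * (calDalev L (cubic d (evenPeriod t)) a ha k + u • Pmodel L (cubic d (evenPeriod t)) (V t) k)⁻¹)
      (castT (cubic d (lev L k * evenPeriod t)) z, f) (castT (cubic d (lev L k * evenPeriod t)) z', g)) atTop (𝓝 s) := by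
  have hd1 : 1 ≤ d := le_trans (by norm_num) hd
  have hd0 : (0 : ℝ) < d := by exact_mod_cast lt_of_lt_of_le zero_lt_one hd1
  have hn : (0 : ℝ) < lev L k := by exact_mod_cast Nat.pos_of_ne_zero (NeZero.ne (lev L k))
  have hside : Tendsto (fun t => lev L k * evenPeriod t) atTop atTop :=
    Filter.Tendsto.const_mul_atTop' (Nat.pos_of_ne_zero (NeZero.ne (lev L k))) tendsto_evenPeriod |>.congr fun t => by ring
  have hα : 0 ≤ α := (hV 0).nonneg.1
  have hκ₀0 : 0 ≤ d * (α + β) * Cst d a := by have := (hV 0).nonneg.2; have := Cst_nonneg d a; positivity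
  have hTκ : T * (d * (α + β) * Cst d a) < 1 := by linarith
  have hJγ : max (JA d a a' κ 1) 0 < gamD d a := max_JA_lt_gamD a hJA
  set C : ℝ := 2 * Real.exp (κ * 4) / (gamD d a - max (JA d a a' κ 1) 0) * Real.exp κ with hC
  have hC0 : 0 ≤ C := by have := sub_pos.mpr hJγ; positivity
  have hδ : 0 < κ / (d * lev L k) := div_pos hκ0 (mul_pos hd0 hn)
  -- `R_k(u)`: decay from the right site read as decay from the left site, EL₂
  have hGr : ∀ t (w : Site d (lev L k * evenPeriod t)) (g : Fin d) (y : Site d (lev L k * evenPeriod t)) (h : Fin d),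
      ‖(calDalev L (cubic d (evenPeriod t)) a ha k + u • Pmodel L (cubic d (evenPeriod t)) (V t) k)⁻¹ (w, g) (y, h)‖
        ≤ C * Real.exp (-(κ / (d * lev L k)) * l1 (windowMap d (lev L k * evenPeriod t) (w - y))) :=
    fun t w g y h => fineWindowDecay_pertInv L a ha ha' hκ0 hγ' hδ' hJA hT₂ (evenPeriod t) (hV t) hu k w y g h
  have hGl : ∀ t (x : Site d (lev L k * evenPeriod t)) (f : Fin d) (w : Site d (lev L k * evenPeriod t)) (g : Fin d),
      ‖(calDalev L (cubic d (evenPeriod t)) a ha k + u • Pmodel L (cubic d (evenPeriod t)) (V t) k)⁻¹ (x, f) (w, g)‖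
        ≤ C * Real.exp (-(κ / (d * lev L k)) * l1 (windowMap d (lev L k * evenPeriod t) (w - x))) := by
    intro t x f w g
    have h := hGr t x f w g
    rwa [show x - w = -(w - x) from (neg_sub w x).symm, l1_windowMap_neg] at h
  have hGel := fun f g w w' => tendsto_pertInv_pair L a ha hd hTκ k hV hV1 hu f g w w'
  -- the letter `A = PR_k(u)`: left-window decay and EL₂
  set CX : ℝ := d * (α * lev L k * ((Real.exp (3 * (κ / (d * lev L k))) + 1) * C)) with hCX
  have hCX0 : 0 ≤ CX := by positivity
  have hXdecl : ∀ t (x : Site d (lev L k * evenPeriod t)) (f : Fin d) (w : Site d (lev L k * evenPeriod t)) (g : Fin d),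
      ‖(Pmodel L (cubic d (evenPeriod t)) (V t) k * (calDalev L (cubic d (evenPeriod t)) a ha k + u • Pmodel L (cubic d (evenPeriod t)) (V t) k)⁻¹) (x, f) (w, g)‖
        ≤ CX * Real.exp (-(κ / (d * lev L k)) * l1 (windowMap d (lev L k * evenPeriod t) (w - x))) := by
    intro t x f w g
    have h := norm_Pmodel_mul_apply_le L (evenPeriod t) (hV t) k hC0 hδ.le (hGr t) x f w g
    rwa [show x - w = -(w - x) from (neg_sub w x).symm, l1_windowMap_neg] at h
  have hXel : ∀ (f g : Fin d) (z z' : Fin d → ℤ), ∃ s : ℂ,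
      Tendsto (fun t => (Pmodel L (cubic d (evenPeriod t)) (V t) k * (calDalev L (cubic d (evenPeriod t)) a ha k + u • Pmodel L (cubic d (evenPeriod t)) (V t) k)⁻¹)
        (castT (cubic d (lev L k * evenPeriod t)) z, f) (castT (cubic d (lev L k * evenPeriod t)) z', g)) atTop (𝓝 s) :=
    tendsto_Pmodel_mul_pair L (side := evenPeriod) k V hV1
      (G := fun t => (calDalev L (cubic d (evenPeriod t)) a ha k + u • Pmodel L (cubic d (evenPeriod t)) (V t) k)⁻¹) hGel
  obtain ⟨hb, hel⟩ := pow_bound_tendsto (d := d) (F := Fin d) (side := fun t => lev L k * evenPeriod t) hside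
    (A := fun t => Pmodel L (cubic d (evenPeriod t)) (V t) k * (calDalev L (cubic d (evenPeriod t)) a ha k + u • Pmodel L (cubic d (evenPeriod t)) (V t) k)⁻¹)
    hδ hCX0 hXdecl hXel n
  -- `(RP)^nR = R(PR)^n`
  simp only [InsertionChainLaw.pow_mul_shift]
  exact tendsto_mul_pair' (d := d) (F := Fin d) (side := fun t => lev L k * evenPeriod t) hside
    (X := fun t => (calDalev L (cubic d (evenPeriod t)) a ha k + u • Pmodel L (cubic d (evenPeriod t)) (V t) k)⁻¹)
    (Y := fun t => (Pmodel L (cubic d (evenPeriod t)) (V t) k * (calDalev L (cubic d (evenPeriod t)) a ha k + u • Pmodel L (cubic d (evenPeriod t)) (V t) k)⁻¹) ^ n)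
    hGl hδ hb hGel hel f g z z'

/-- **`tendsto_pertChain_pair` — EL₂ OF `X^{(n)}_k(u)` ON THE UNIT LATTICE, MODULO EL₁ OF THE BACKGROUND** [our proof] (`d ≥ 3`, even cubic volumes, PART 129's disc): PART 151's
middle-free stencil on `tendsto_pertChain_fine_pair`. [cite: Balaban1987RG1, p.264 (after (1.21): the `T ↗ ℤ^d` limit)] -/
theorem tendsto_pertChain_pair (hd : 3 ≤ d) {α β a' κ T : ℝ} (ha' : 0 < a') (hκ0 : 0 < κ)
    (hγ' : Jfree d a' κ 1 < gammaPs d a') (hδ' : deltaK d a' κ 1 < sigma0 d a' ^ 2) (hJA : JA d a a' κ 1 < gamD d a)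
    (hT₁ : T * (d * (α + β) * Cst d a) ≤ 1 / 2)
    (hT₂ : T * (d * (α * G2 d a (max (JA d a a' κ 1) 0) (gamD d a - max (JA d a a' κ 1) 0) κ)) ≤ 1 / 2) (k : ℕ)
    {V : (t : ℕ) → (k : ℕ) → Fin d → (idx L (cubic d (evenPeriod t)) k → ℂ)} (hV : ∀ t, LipschitzBackground L (cubic d (evenPeriod t)) (V t) α β)
    (hV1 : ∀ (μ f : Fin d) (z : Fin d → ℤ), ∃ s : ℂ, Tendsto (fun t => V t k μ (castT (cubic d (lev L k * evenPeriod t)) z, f)) atTop (𝓝 s))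
    {u : ℂ} (hu : ‖u‖ ≤ T) (n : ℕ) (μ ν : Fin d) (z z' : Fin d → ℤ) :
    ∃ s : ℂ, Tendsto (fun t => (avgTow (QBlev L (cubic d (evenPeriod t))) ((L : ℝ) ^ d)
        (fun k' => ((calDalev L (cubic d (evenPeriod t)) a ha k' + u • Pmodel L (cubic d (evenPeriod t)) (V t) k')⁻¹ * Pmodel L (cubic d (evenPeriod t)) (V t) k') ^ n
          * (calDalev L (cubic d (evenPeriod t)) a ha k' + u • Pmodel L (cubic d (evenPeriod t)) (V t) k')⁻¹) k)
      ((unitIdx L (cubic d (evenPeriod t))).symm (castT (cubic d (evenPeriod t)) z, μ)) ((unitIdx L (cubic d (evenPeriod t))).symm (castT (cubic d (evenPeriod t)) z', ν))) atTop (𝓝 s) := by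
  obtain ⟨s, hs⟩ := tendsto_avgTow_pair_of_fine L k
    (X := fun t k' => ((calDalev L (cubic d (evenPeriod t)) a ha k' + u • Pmodel L (cubic d (evenPeriod t)) (V t) k')⁻¹ * Pmodel L (cubic d (evenPeriod t)) (V t) k') ^ n
      * (calDalev L (cubic d (evenPeriod t)) a ha k' + u • Pmodel L (cubic d (evenPeriod t)) (V t) k')⁻¹)
    (fun f g w w' => tendsto_pertChain_fine_pair L a ha hd ha' hκ0 hγ' hδ' hJA hT₁ hT₂ k hV hV1 hu n f g w w') μ ν z z'
  refine ⟨s, hs.congr fun t => ?_⟩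
  simp only [Matrix.reindex_apply, Matrix.submatrix_apply]

end ChainLimits

/-! ## §5 The INPUT triple of the insertion chains at coupling `u` along the even cubic volumes -/

/-- **`pertChain_inputs` — THE INPUT TRIPLE ((UD), (SR), EL₂) OF `X^{(n)}(u)` ALONG THE EVEN CUBIC VOLUMES** [our proof] (`L ≥ 2`, `d ≥ 3`, PART 129's disc, `‖u‖ ≤ T`; a volume-indexed
family of Lipschitz backgrounds `(α, β)` DISPLAYING ONLY EL₁): `∃ κ₁ > 0, B, B′ ≥ 0` (free of `t, k, u`) with (UD)+(SR) of `X^{(n)}(u)` on every `cubic d (2(t+1))` and EL₂ at unit integer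
pairs — the format of PART 160's `list_prod_inputs` (PART 159's `wordInsertion_inputs` is `u = 0`). -/
theorem pertChain_inputs (hL : 2 ≤ L) (hd : 3 ≤ d) {α β a' κ T : ℝ} (hα : 0 ≤ α) (hβ : 0 ≤ β) (ha' : 0 < a') (hκ0 : 0 < κ)
    (hγ' : Jfree d a' κ 1 < gammaPs d a') (hδ' : deltaK d a' κ 1 < sigma0 d a' ^ 2) (hJA : JA d a a' κ 1 < gamD d a) (hT0 : 0 ≤ T)
    (hT₁ : T * (d * (α + β) * Cst d a) ≤ 1 / 2)
    (hT₂ : T * (d * (α * G2 d a (max (JA d a a' κ 1) 0) (gamD d a - max (JA d a a' κ 1) 0) κ)) ≤ 1 / 2)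
    {V : (t : ℕ) → (k : ℕ) → Fin d → (idx L (cubic d (evenPeriod t)) k → ℂ)} (hV : ∀ t, LipschitzBackground L (cubic d (evenPeriod t)) (V t) α β)
    (hV1 : ∀ k (μ f : Fin d) (z : Fin d → ℤ), ∃ s : ℂ, Tendsto (fun t => V t k μ (castT (cubic d (lev L k * evenPeriod t)) z, f)) atTop (𝓝 s))
    {u : ℂ} (hu : ‖u‖ ≤ T) (n : ℕ) :
    ∃ κ₁ B B' : ℝ, 0 < κ₁ ∧ 0 ≤ B ∧ 0 ≤ B' ∧
      (∀ t k, EntryDecay (distK L (cubic d (evenPeriod t))) (avgTow (QBlev L (cubic d (evenPeriod t))) ((L : ℝ) ^ d)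
        (fun k' => ((calDalev L (cubic d (evenPeriod t)) a ha k' + u • Pmodel L (cubic d (evenPeriod t)) (V t) k')⁻¹ * Pmodel L (cubic d (evenPeriod t)) (V t) k') ^ n
          * (calDalev L (cubic d (evenPeriod t)) a ha k' + u • Pmodel L (cubic d (evenPeriod t)) (V t) k')⁻¹) k) B κ₁) ∧
      (∀ t, TwoLevelDecayRate (distK L (cubic d (evenPeriod t))) (avgTow (QBlev L (cubic d (evenPeriod t))) ((L : ℝ) ^ d)
        (fun k' => ((calDalev L (cubic d (evenPeriod t)) a ha k' + u • Pmodel L (cubic d (evenPeriod t)) (V t) k')⁻¹ * Pmodel L (cubic d (evenPeriod t)) (V t) k') ^ n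
          * (calDalev L (cubic d (evenPeriod t)) a ha k' + u • Pmodel L (cubic d (evenPeriod t)) (V t) k')⁻¹)) B' κ₁ (Real.sqrt ((L : ℝ)⁻¹))) ∧
      (∀ k μ ν (z z' : Fin d → ℤ), ∃ s' : ℂ, Tendsto (fun t => (avgTow (QBlev L (cubic d (evenPeriod t))) ((L : ℝ) ^ d)
        (fun k' => ((calDalev L (cubic d (evenPeriod t)) a ha k' + u • Pmodel L (cubic d (evenPeriod t)) (V t) k')⁻¹ * Pmodel L (cubic d (evenPeriod t)) (V t) k') ^ n
          * (calDalev L (cubic d (evenPeriod t)) a ha k' + u • Pmodel L (cubic d (evenPeriod t)) (V t) k')⁻¹) k)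
        ((unitIdx L (cubic d (evenPeriod t))).symm (castT (cubic d (evenPeriod t)) z, μ)) ((unitIdx L (cubic d (evenPeriod t))).symm (castT (cubic d (evenPeriod t)) z', ν)))
        atTop (𝓝 s')) := by
  have hd1 : 1 ≤ d := le_trans (by norm_num) hd
  obtain ⟨κ₁, B, B', hκ₁, hB, hB', h⟩ := pertChain_decay_inputs L a ha hL hd1 hα hβ ha' hκ0 hγ' hδ' hJA hT0 hT₁ hT₂ n
  exact ⟨κ₁, B, B', hκ₁, hB, hB', fun t k => (h (cubic d (evenPeriod t)) (V t) (hV t) u hu).1 k, fun t => (h (cubic d (evenPeriod t)) (V t) (hV t) u hu).2,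
    fun k μ ν z z' => tendsto_pertChain_pair L a ha hd ha' hκ0 hγ' hδ' hJA hT₁ hT₂ k hV (hV1 k) hu n μ ν z z'⟩

end Summit.QuantumFields.BalabanUV.Beta.GAN24.PerturbedInsertionChainVolumeLimit

end
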